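import Summits.BirchSwinnertonDyer.Rank1Residual.Additive.GoodModelReductionDatum
import Literature.NumberTheory.EllipticCurves.NeronOggShafarevichLocalProofs
import HarnessLib

/-!
# T-ROL-G F-A3: `IsRamifiedOrdinaryLine W p L` for the good-model line — inertia acts on `E[p^∞]/C`
# through a finite quotient, NON-trivially at a bad place (Néron–Ogg–Shafarevich); assembly
# (team n1011, row T-ROL-G; seat p05 GEN 5; lead R5-57; referee-1 ACK-1 GEN 16)

HONEST FRAMING (cell `b2b-bsdres`, run/shared/lean/b2b/bsd-rank1-residual/, verbatim in every
file): the goal of the cell is to DELETE the COMBINATION-SHAPED residual classes of the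
Birch–Swinnerton-Dyer formula for ALL analytic-rank `≤ 1` elliptic curves over `ℚ` — "full BSD
formula for every rank `≤ 1` curve in class `C`" assembled STRICTLY from published theorems — so
that the rank-`≤ 1` remainder becomes exactly the CONSTRUCTION-SHAPED classes, which are TYPED
(missing-input `Prop`s), NOT attempted. This is not "finishing BSD". Team n1011 (N10/N11): research
route on the CONSTRUCTION-SHAPED classes X3♯(G-ord)/X4♯(G-ord); prove what is provable now; no
claim beyond stated classes; census output = EVIDENCE, never a Literature fact; RESIDUAL-MAP marks
UNCHANGED; nothing is booked by this file. TOOL theorems only: NO definition, NO named fact, NO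
conjecture node.

## The row (T-ROL-G) in one paragraph

p10's TB-ROL FILE B (`Additive/GordRamifiedOrdinaryLine.lean`) constructs the ramified ordinary
line of an X4♯(G-ord)/X3♯(G-ord) row as Greenberg's `C_v(V)` of a `ℚ`-MODEL `V` of the `p*`-twist,
hence only for the defect `e_E(p) = 2` (Kodaira `I₀*`). On the rows with `e ∈ {3, 4, 6}` (`p ≥ 5`,
`p ≡ 1 (mod e)`; N10 `CellGordHigher`) no curve over `ℚ` plays `V` (class file of record:
"Gord_e346 — line existence / R-D untyped", class-closure/N10/WEEK-2026-08-28-INPUT-typer2 §5). The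
row builds the line WITHOUT a twist model and WITHOUT any number-field extension, from a **good
model** `W₀ = C • E ⊗ K̄_v` — a Weierstrass equation with unit discriminant over the valuation ring
`𝒪_w` of the spectral valuation `w = |·|_v` of `K̄_v = \overline{ℚ_v}`, `C` a change of variables
over `K̄_v` (it exists iff `ord_p j(E) ≥ 0`: Deuring's form, the tree's
`exists_variableChange_eq_baseChange_isUnit_Δ_of_val_j_le_one`) — as
`C = E[p^∞] ∩ ker(red_{W₀} ∘ Φ_C ∘ ι)` (`Φ_C` the substitution, `ι : E(ℚ̄) → E(K̄_v)` the chosen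
embedding), and proves the five conjuncts of cc-typer-1's
`EmertonPollackWeston2006.IsRamifiedOrdinaryLine W p` (EPW §3.1's `A'_{f̃,a}`; Coates' canonical
subgroup, LNM 1716 (62); Greenberg's `ℱ[p^∞]` over the good field, LNM 1716 §2 pp. 62–63) from tree
theorems only. Three files: F-A1 `GoodModelReductionKernel` (valued-field level), F-A2
`GoodModelReductionDatum` (the datum; divisible / proper / non-zero / infinitely many reductions
under the ordinary hypothesis), F-A3 `GoodModelReductionLine` (inertia finite + non-trivial;
assembly).

## This file

* §1 `exists_pos_forall_inertia_pow_smul_sub_mem_plus` — inertia acts on `E[p^∞]/C` through a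
  FINITE quotient: a uniform power of every inertia element fixes the entries of `C` (F-A1
  `exists_pos_forall_pow_smul_eq`), and an inertial isometry fixing the good model does not change
  reductions (F-A1 `goodReductionHom_pointEquiv_map_eq_of_map_eq`).
* §2 `smul_eq_of_forall_smul_sub_mem_plus`, **`exists_inertia_smul_sub_not_mem_plus`** — at a place
  of BAD reduction inertia moves `E[p^∞]/C`: otherwise Serre–Tate's reduced automorphism `Ã_σ`
  (`exists_reducedAut_red_map_eq`) fixes the infinitely many reductions of `p`-power torsion points
  (F-A2 `infinite_range_red_pointsMap`), so `Ã_σ = 1` (`VariableChange.eq_one_of_infinite_fixedPoints`),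
  inertia fixes all prime-to-`p` torsion (*AEC* VII.3.1(b),
  `eq_zero_of_zsmul_eq_zero_of_goodReductionHom_eq_zero`), and `E` is good at `v` by
  Néron–Ogg–Shafarevich (`hasGoodReductionAt_of_infinite_unramifiedTorsion_holds`, *AEC* VII.7.1);
  `infinite_setOf_not_dvd`.
* §3 **`isRamifiedOrdinaryLine_of_goodModel`**, **`exists_isRamifiedOrdinaryLine_of_goodModel`** —
  cc-typer-1's five conjuncts for the good-model datum, hypotheses EXACTLY: a good model
  `(C, W₀, hW₀, hΔ)`, the ordinary point `hord`, `p ∈ v`, `¬ W.HasGoodReductionAt v` — for EVERY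
  semistability defect; the `e ∈ {3,4,6}` class theorems (good model from `TypeGOrd` by Deuring's
  form; ordinary point from `j̃ ∈ {0, 1728}`, additive-p2's `SpecialJOrdinary`) are the row's files
  F-B/F-C.

Binder honesty: no class predicate, no `semistabilityIndex`, no twist, no named fact enters. NOT
claimed: uniqueness of the line on `e ∈ {3,4,6}` (cc-typer-2's `plus_eq_of_inertia_scalar` + a
Weil-pairing scalar for a general good model — her sequel S1), the Kummer/R-D identification
(`RamifiedLineKummerEqAt`, sequel S2 + p05's located gap T-RD-E346), (M) rows, `p = 2`.

References: J.-P. Serre, J. Tate, Ann. of Math. 88 (1968) §2 Thm. 2, Cor. 2 [SerreTate1968];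
J. H. Silverman, *AEC* 2nd ed. VII.1.3(d), VII.2.1, VII.3.1(b), VII.5.5, VII.7.1, III.6.4(b)
[SilvermanAEC2009]; R. Greenberg, LNM 1716 (1999) §1 p. 62, §2 pp. 62–63 [GreenbergLNM1716];
J. Coates, LNM 1716 (1999) p. 31 (62) [CoatesLNM1716]; M. Emerton, R. Pollack, T. Weston, Invent.
Math. 163 (2006) §3.1 (arXiv:math/0404484 p. 17) [EmertonPollackWeston2006]; J. Neukirch, *ANT*
IV §1 (Krull topology); cells/n1011/skel/T-ROL-G.md (fa05b6d488a62a53), referee-1 GEN 16 ACK-1,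
lead R5-57; class-closure/N10/WEEK-2026-08-28-INPUT-typer2.md §2/§3/§5.
-/

noncomputable section

open scoped Classical NNReal

open WeierstrassCurve

universe u

namespace Summit.BirchSwinnertonDyer.Rank1Residual.Additive.GoodModelLine

open Literature.NumberTheory.EllipticCurves


section Local

open NumberField IsDedekindDomain Field IsDedekindDomain.HeightOneSpectrum
  Literature.NumberTheory.GaloisRepresentations
  Literature.NumberTheory.EllipticCurves.GreenbergSelmer
  Literature.NumberTheory.EllipticCurves.EmertonPollackWeston2006
  Summit.BirchSwinnertonDyer.Rank1Residual.X2.GreenbergVatsalReductionDatum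
  Summit.BirchSwinnertonDyer.Rank1Residual.X2.GreenbergVatsalTateDatumCofree

variable (W : WeierstrassCurve ℚ) [W.IsElliptic] (p : ℕ) [hp : Fact p.Prime]
  {v : HeightOneSpectrum (𝓞 ℚ)}
  {C : VariableChange (AlgebraicClosure (v.adicCompletion ℚ))}
  {W₀ : WeierstrassCurve (specVal v).integer}
  (hW₀ : C • (W.baseChange (v.adicCompletion ℚ)).baseChange (AlgebraicClosure (v.adicCompletion ℚ)) =
    W₀.baseChange (AlgebraicClosure (v.adicCompletion ℚ)))
  (hΔ : IsUnit W₀.Δ)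
  (red : localPoints W (v.adicCompletion ℚ) →+
    (W₀.map (IsLocalRing.residue (specVal v).integer)).toAffine.Point)
  (hred : ∀ P, red P = goodReductionHom W₀ (Valuation.integer.integers (specVal v)) hΔ
    (Affine.Point.congrEquiv hW₀ (VariableChange.pointEquiv _ C
      (Affine.Point.congrEquiv (baseChange_baseChange_adicCompletion W v).symm P))))


variable (hord : ∃ P : (W₀.baseChange (AlgebraicClosure (v.adicCompletion ℚ))).toAffine.Point,
    (p : ℤ) • P = 0 ∧ goodReductionHom W₀ (Valuation.integer.integers (specVal v)) hΔ P ≠ 0)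
  (Lv : LocalDatum ℚ (W.geomPrimaryTorsion p) v)
  (hLv : ∀ m, m ∈ Lv.plus ↔ red (pointsMap W (v.adicCompletion ℚ) (m : W.geomPoints)) = 0)

/-! ## §1 Inertia acts on `E[p^∞]/C` through a finite quotient -/

omit [W.IsElliptic] hp in
include hred hLv in
/-- **Inertia acts on `E[p^∞]/C` through a FINITE quotient** (fourth conjunct): some `n ≥ 1` with
`σⁿ m − m ∈ C` for every local inertia element `σ` and every `m ∈ E[p^∞]`. Take `n` with `σⁿ`
fixing the four entries of `C` for every `σ ∈ Γ_{ℚ_v}` (`exists_pos_forall_pow_smul_eq`: they are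
algebraic over `ℚ_v`); then `σⁿ` is an inertial isometry fixing the good model, so it does not
change reductions (`goodReductionHom_pointEquiv_map_eq_of_map_eq`), i.e. `red(ι(σⁿ m)) = red(ι m)`.
(Serre–Tate: inertia acts on the reduction of the good model through the finite image of the
descent datum `σ ↦ Ã_σ ∈ Aut(W̃₀)`.) [cite: SerreTate1968, §2 Thm. 2 and Cor. 2]
[cite: SilvermanAEC2009, Prop. VII.2.1] -/
theorem exists_pos_forall_inertia_pow_smul_sub_mem_plus :
    ∃ n : ℕ, 0 < n ∧ ∀ σ ∈ absInertia (v.adicCompletion ℚ), ∀ m : W.geomPrimaryTorsion p,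
      (absGaloisRestrict ℚ (v.adicCompletion ℚ) σ) ^ n • m - m ∈ Lv.plus := by
  obtain ⟨𝔐, h𝔐⟩ := v.localPrimesAbove_nonempty
  obtain ⟨n, hn, hfix⟩ := exists_pos_forall_pow_smul_eq (K := v.adicCompletion ℚ)
    (S := {((C.u : (AlgebraicClosure (v.adicCompletion ℚ))ˣ) : AlgebraicClosure (v.adicCompletion ℚ)),
      C.r, C.s, C.t}) (Set.toFinite _)
  refine ⟨n, hn, fun σ hσ m ↦ ?_⟩
  set τ : absoluteGaloisGroup (v.adicCompletion ℚ) := σ ^ n with hτ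
  have hτI : τ ∈ absInertia (v.adicCompletion ℚ) := Subgroup.pow_mem _ hσ n
  have hτI' : τ ∈ 𝔐.inertia (absoluteGaloisGroup (v.adicCompletion ℚ)) := by
    rw [inertia_eq_absInertia (specVal_spec v) h𝔐]; exact hτI
  have hmove := (mem_inertia_iff_spectralValuation (specVal_spec v) h𝔐).1 hτI'
  have hC : C.map ((absoluteGaloisGroup.toAlgEquiv _ τ :
      AlgebraicClosure (v.adicCompletion ℚ) ≃ₐ[v.adicCompletion ℚ]
        AlgebraicClosure (v.adicCompletion ℚ)) :
      AlgebraicClosure (v.adicCompletion ℚ) →+* AlgebraicClosure (v.adicCompletion ℚ)) = C := by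
    have key : ∀ c ∈ ({((C.u : (AlgebraicClosure (v.adicCompletion ℚ))ˣ) :
        AlgebraicClosure (v.adicCompletion ℚ)), C.r, C.s, C.t} :
        Set (AlgebraicClosure (v.adicCompletion ℚ))),
        (absoluteGaloisGroup.toAlgEquiv _ τ) c = c := fun c hc ↦ by
      rw [← absoluteGaloisGroup.smul_def, hτ]; exact hfix σ c hc
    ext
    · simp only [VariableChange.map, Units.coe_map, MonoidHom.coe_coe, RingHom.coe_coe]
      exact key _ (by simp)
    · exact key _ (by simp)
    · exact key _ (by simp)
    · exact key _ (by simp)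
  rw [hLv, ← map_pow, ← hτ, AddSubgroupClass.coe_sub, primaryComponent.coe_smul, map_sub,
    pointsMap_absGaloisRestrict_smul, map_sub, sub_eq_zero, hred, hred, congrEquiv_smul W v τ]
  exact goodReductionHom_pointEquiv_map_eq_of_map_eq (W.baseChange (v.adicCompletion ℚ)) C hW₀ hΔ
    (absoluteGaloisGroup.toAlgEquiv _ τ) (fun z ↦ spectralValuation_smul (specVal_spec v) τ z)
    hmove hC _

/-! ## §2 At a BAD place the inertia action on `E[p^∞]/C` is non-trivial (Néron–Ogg–Shafarevich) -/

set_option maxHeartbeats 400000 in -- the Serre–Tate transport elaborates near the build lane's cliff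
include hred hLv hord in
/-- **An inertia element acting trivially on `E[p^∞]/C` fixes every prime-to-`p` torsion point of
`E(K̄_v)`.** For an inertial `σ` with `σm − m ∈ C` for all `m ∈ E[p^∞]`, the reduced automorphism
`Ã_σ` of Serre–Tate (`exists_reducedAut_red_map_eq`: `red(Φ(P^σ)) = Ã_σ(red(ΦP))`) fixes the
infinitely many reductions of `p`-power torsion points (`infinite_range_red_pointsMap`), so
`Ã_σ = 1` (`eq_one_of_infinite_fixedPoints`); hence `red(Φ(P^σ)) = red(ΦP)` for EVERY `P`, and
for `P` killed by `n` prime to `p` the point `Φ(P^σ) − Φ(P)` is an `n`-torsion point of the kernel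
of reduction, i.e. `O` (*AEC* VII.3.1(b), `eq_zero_of_zsmul_eq_zero_of_goodReductionHom_eq_zero`).
[cite: SerreTate1968, §2 Thm. 2 and Cor. 2] [cite: SilvermanAEC2009, Prop. VII.3.1(b)] -/
theorem smul_eq_of_forall_smul_sub_mem_plus (hpv : ((p : ℕ) : 𝓞 ℚ) ∈ v.asIdeal)
    {σ : absoluteGaloisGroup (v.adicCompletion ℚ)} (hσ : σ ∈ absInertia (v.adicCompletion ℚ))
    (hHσ : ∀ m : W.geomPrimaryTorsion p, absGaloisRestrict ℚ (v.adicCompletion ℚ) σ • m - m ∈ Lv.plus)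
    {n : ℕ} (hpn : ¬ p ∣ n) (P : localPoints W (v.adicCompletion ℚ)) (hnP : n • P = 0) :
    σ • P = P := by
  obtain ⟨𝔐, h𝔐⟩ := v.localPrimesAbove_nonempty
  let Φ₁ : localPoints W (v.adicCompletion ℚ) ≃+
      ((W.baseChange (v.adicCompletion ℚ)).baseChange (AlgebraicClosure (v.adicCompletion ℚ))).toAffine.Point :=
    Affine.Point.congrEquiv (baseChange_baseChange_adicCompletion W v).symm
  let Φ : localPoints W (v.adicCompletion ℚ) ≃+
      (W₀.baseChange (AlgebraicClosure (v.adicCompletion ℚ))).toAffine.Point :=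
    (Φ₁.trans (VariableChange.pointEquiv _ C)).trans (Affine.Point.congrEquiv hW₀)
  have hredΦ : ∀ P, red P = goodReductionHom W₀ (Valuation.integer.integers (specVal v)) hΔ (Φ P) :=
    fun P ↦ hred P
  have hΦ₁smul : ∀ Q : localPoints W (v.adicCompletion ℚ),
      Φ₁ (σ • Q) = Affine.Point.map ((absoluteGaloisGroup.toAlgEquiv (v.adicCompletion ℚ) σ) :
        AlgebraicClosure (v.adicCompletion ℚ) →ₐ[v.adicCompletion ℚ]
        AlgebraicClosure (v.adicCompletion ℚ)) (Φ₁ Q) :=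
    fun Q ↦ congrEquiv_smul W v σ Q
  have hσv : ∀ z, specVal v ((absoluteGaloisGroup.toAlgEquiv (v.adicCompletion ℚ) σ) z) = specVal v z :=
    fun z ↦ spectralValuation_smul (specVal_spec v) σ z
  have hσI' : σ ∈ 𝔐.inertia (absoluteGaloisGroup (v.adicCompletion ℚ)) := by
    rw [inertia_eq_absInertia (specVal_spec v) h𝔐]; exact hσ
  have hσI : ∀ z, specVal v z ≤ 1 → specVal v ((absoluteGaloisGroup.toAlgEquiv (v.adicCompletion ℚ) σ) z - z) < 1 :=
    (mem_inertia_iff_spectralValuation (specVal_spec v) h𝔐).1 hσI'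
  obtain ⟨Ã, hÃ, hT⟩ := exists_reducedAut_red_map_eq (w := specVal v)
    (W.baseChange (v.adicCompletion ℚ)) C hW₀ hΔ (absoluteGaloisGroup.toAlgEquiv (v.adicCompletion ℚ) σ) hσv hσI
  -- `Ã = 1`: it fixes the infinitely many reductions of `p`-power torsion points
  have hÃ1 : Ã = 1 := by
    apply VariableChange.eq_one_of_infinite_fixedPoints hÃ
    refine (infinite_range_red_pointsMap W p hW₀ hΔ red hred hord hpv).mono ?_
    rintro _ ⟨m, rfl⟩
    have h1 := hT (Φ₁ (pointsMap W (v.adicCompletion ℚ) (m : W.geomPoints)))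
    rw [← hΦ₁smul, ← pointsMap_absGaloisRestrict_smul] at h1
    have h2 := hHσ m
    rw [hLv, AddSubgroupClass.coe_sub, primaryComponent.coe_smul, map_sub, map_sub, sub_eq_zero,
      hred, hred] at h2
    rw [Set.mem_setOf_eq]
    dsimp only
    rw [hred]
    exact (h2 ▸ h1).symm
  -- hence `red(Φ(P^σ)) = red(Φ P)` for every `P`
  have hT1 := fun P' ↦ (hT P').trans (congrEquiv_pointEquiv_one _ hÃ hÃ1 _)
  -- the point `Φ(P^σ) − Φ(P)` is prime-to-`p` torsion in the kernel of reduction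
  have hDred : goodReductionHom W₀ (Valuation.integer.integers (specVal v)) hΔ (Φ (σ • P) - Φ P) = 0 := by
    rw [map_sub, sub_eq_zero]
    have h := hT1 (Φ₁ P)
    rw [← hΦ₁smul] at h
    exact h
  have hDn : (n : ℤ) • (Φ (σ • P) - Φ P) = 0 := by
    have hc : n • σ • P = σ • (n • P) :=
      (map_nsmul (DistribSMul.toAddMonoidHom (localPoints W (v.adicCompletion ℚ)) σ) n P).symm
    rw [zsmul_sub, natCast_zsmul, natCast_zsmul, ← map_nsmul, ← map_nsmul, hc, hnP, smul_zero,
      sub_self]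
  have hwn : specVal v ((n : ℤ) : AlgebraicClosure (v.adicCompletion ℚ)) = 1 :=
    spectralValuation_intCast_eq_one_of_natCast_mem hpv (specVal_spec v) (by exact_mod_cast hpn)
  have hD0 : Φ (σ • P) - Φ P = 0 := eq_zero_of_zsmul_eq_zero_of_goodReductionHom_eq_zero
    (Valuation.integer.integers (specVal v)) hΔ hwn hDn hDred
  rw [sub_eq_zero] at hD0
  exact Φ.injective hD0

/-- The set of natural numbers prime to `p` is infinite. [folklore] -/
theorem infinite_setOf_not_dvd : {n : ℕ | ¬ p ∣ n}.Infinite := by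
  refine Set.infinite_of_not_bddAbove ?_
  rintro ⟨N, hN⟩
  have hmem : N * p + 1 ∈ {n : ℕ | ¬ p ∣ n} := by
    intro h
    have h1 : p ∣ 1 := (Nat.dvd_add_right (dvd_mul_left p N)).mp h
    exact hp.out.one_lt.ne' (Nat.dvd_one.mp h1)
  have hle := hN hmem
  have hp1 := hp.out.one_lt
  nlinarith

include hred hLv hord in
/-- **Inertia moves `E[p^∞]/C` at a place of bad reduction** (fifth conjunct). If every local
inertia element acted trivially on `E[p^∞]/C`, every inertia element would fix every prime-to-`p`
torsion point of `E(K̄_v)` (`smul_eq_of_forall_smul_sub_mem_plus`), and `E` would have good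
reduction at `v` by the criterion of Néron–Ogg–Shafarevich
(`hasGoodReductionAt_of_infinite_unramifiedTorsion_holds`, Silverman *AEC* VII.7.1) — contradiction.
So at an ADDITIVE potentially good ordinary prime the quotient character `θ : I_v → Aut(Ẽ)` is
non-trivial: EPW's branch `a ≢ 0`. [cite: SerreTate1968, §2 Thm. 2 and Cor. 2]
[cite: SilvermanAEC2009, Thm. VII.7.1 and Prop. VII.3.1(b)]
[cite: EmertonPollackWeston2006, §3.1 (eq:ordes) (arXiv:math/0404484 p. 17)] -/
theorem exists_inertia_smul_sub_not_mem_plus (hpv : ((p : ℕ) : 𝓞 ℚ) ∈ v.asIdeal)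
    (hbad : ¬ W.HasGoodReductionAt v) :
    ∃ σ ∈ absInertia (v.adicCompletion ℚ), ∃ m : W.geomPrimaryTorsion p,
      absGaloisRestrict ℚ (v.adicCompletion ℚ) σ • m - m ∉ Lv.plus := by
  by_contra H
  push Not at H
  obtain ⟨𝔐, h𝔐⟩ := v.localPrimesAbove_nonempty
  apply hbad
  refine (hasGoodReductionAt_of_infinite_unramifiedTorsion_iff W).mp
    W.hasGoodReductionAt_of_infinite_unramifiedTorsion_holds v h𝔐 ?_
  refine (infinite_setOf_not_dvd p).mono ?_
  intro n hn
  refine ⟨?_, fun σ hσ P hP ↦ ?_⟩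
  · have h := intCast_not_mem_asIdeal_of_natCast_mem hpv (n := (n : ℤ)) (by exact_mod_cast hn)
    simpa using h
  · rw [inertia_eq_absInertia (specVal_spec v) h𝔐] at hσ
    exact smul_eq_of_forall_smul_sub_mem_plus W p hW₀ hΔ red hred hord Lv hLv hpv hσ (H σ hσ) hn P hP

/-! ## §3 Assembly: the good-model line IS a ramified ordinary line -/

include hred hLv hord in
/-- **THE RAMIFIED ORDINARY LINE OF A GOOD MODEL.** `E/ℚ` elliptic, `v ∋ p`, `W₀ = C • E ⊗ K̄_v` a
unit-discriminant model over the valuation ring of the spectral valuation of `K̄_v` (a GOOD MODEL —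
it exists iff `E` has potentially good reduction at `p`, Deuring / *AEC* VII.5.5), ORDINARY
("some `p`-torsion point of `W₀(K̄_v)` has non-zero reduction", the tree's ordinary hypothesis), and
`E` WITHOUT good reduction at `v` (e.g. additive). Then the local datum
`C = E[p^∞] ∩ ker(red_{W₀} ∘ Φ_C)` satisfies cc-typer-1's `IsRamifiedOrdinaryLine W p`: divisible,
`≠ E[p^∞]`, `≠ 0`, inertia through a finite quotient, and NON-trivially. No twist model, no
number-field extension, no named fact: the Serre–Tate line at an additive potentially good
ordinary prime of ANY semistability defect `e ∈ {2,3,4,6}` (EPW's `A'_{f̃,a}`, Coates' canonical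
subgroup, Greenberg's `ℱ[p^∞]` over the good field).
[cite: EmertonPollackWeston2006, §3.1 (eq:ordes) (arXiv:math/0404484 p. 17)]
[cite: SerreTate1968, §2 Thm. 2 and Cor. 2] [cite: GreenbergLNM1716, §1 p. 62 and §2 p. 63]
[cite: CoatesLNM1716, p. 31 (62) (the canonical subgroup C)] -/
theorem isRamifiedOrdinaryLine_of_goodModel (hpv : ((p : ℕ) : 𝓞 ℚ) ∈ v.asIdeal)
    (hbad : ¬ W.HasGoodReductionAt v) : IsRamifiedOrdinaryLine W p Lv :=
  ⟨plus_divisible_of_goodModel W p hW₀ hΔ red hred hord Lv hLv hpv,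
    plus_ne_top_of_goodModel W p hW₀ hΔ red hred hord Lv hLv,
    plus_ne_bot_of_goodModel W p hW₀ hΔ red hred hord Lv hLv hpv,
    exists_pos_forall_inertia_pow_smul_sub_mem_plus W p hW₀ hΔ red hred Lv hLv,
    exists_inertia_smul_sub_not_mem_plus W p hW₀ hΔ red hred hord Lv hLv hpv hbad⟩

set_option maxHeartbeats 400000 in -- `hred` by `rfl` through three transports
include hord in
omit red hred Lv hLv in
/-- **EXISTENCE of the ramified ordinary line from a good ordinary model at a bad place** (the
`∃ L, IsRamifiedOrdinaryLine W p L` binder of Route G's EPW consumers, for every `E/ℚ` with a good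
ORDINARY model over `𝒪_w ⊂ K̄_v` and bad reduction at `v ∋ p` — the shape consumed by
`exists_isRamifiedOrdinaryLine`-type class theorems), together with the explicit description of the
line as the `p`-power torsion of the kernel of reduction of the good model.
[cite: EmertonPollackWeston2006, §3.1 (eq:ordes) (arXiv:math/0404484 p. 17)]
[cite: SerreTate1968, §2 Thm. 2 and Cor. 2] [cite: GreenbergLNM1716, §1 p. 62 and §2 p. 63] -/
theorem exists_isRamifiedOrdinaryLine_of_goodModel (hpv : ((p : ℕ) : 𝓞 ℚ) ∈ v.asIdeal)
    (hbad : ¬ W.HasGoodReductionAt v) :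
    ∃ Lv : LocalDatum ℚ (W.geomPrimaryTorsion p) v, IsRamifiedOrdinaryLine W p Lv ∧
      ∀ m, m ∈ Lv.plus ↔ goodReductionHom W₀ (Valuation.integer.integers (specVal v)) hΔ
        (Affine.Point.congrEquiv hW₀ (VariableChange.pointEquiv _ C
          (Affine.Point.congrEquiv (baseChange_baseChange_adicCompletion W v).symm
            (pointsMap W (v.adicCompletion ℚ) (m : W.geomPoints))))) = 0 := by
  let Φ₁ : localPoints W (v.adicCompletion ℚ) ≃+
      ((W.baseChange (v.adicCompletion ℚ)).baseChange (AlgebraicClosure (v.adicCompletion ℚ))).toAffine.Point :=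
    Affine.Point.congrEquiv (baseChange_baseChange_adicCompletion W v).symm
  let Φ : localPoints W (v.adicCompletion ℚ) ≃+
      (W₀.baseChange (AlgebraicClosure (v.adicCompletion ℚ))).toAffine.Point :=
    (Φ₁.trans (VariableChange.pointEquiv _ C)).trans (Affine.Point.congrEquiv hW₀)
  let red : localPoints W (v.adicCompletion ℚ) →+
      (W₀.map (IsLocalRing.residue (specVal v).integer)).toAffine.Point :=
    (goodReductionHom W₀ (Valuation.integer.integers (specVal v)) hΔ).comp Φ.toAddMonoidHom
  have hred : ∀ P, red P = goodReductionHom W₀ (Valuation.integer.integers (specVal v)) hΔ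
      (Affine.Point.congrEquiv hW₀ (VariableChange.pointEquiv _ C
        (Affine.Point.congrEquiv (baseChange_baseChange_adicCompletion W v).symm P))) := fun _ ↦ rfl
  obtain ⟨Lv, hLv⟩ := exists_localDatum_mem_iff_red_eq_zero W p hW₀ hΔ red hred
  exact ⟨Lv, isRamifiedOrdinaryLine_of_goodModel W p hW₀ hΔ red hred hord Lv hLv hpv hbad,
    fun m ↦ (hLv m).trans (by rw [hred])⟩

end Local

end Summit.BirchSwinnertonDyer.Rank1Residual.Additive.GoodModelLine

end
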